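import Mathlib.NumberTheory.DirichletCharacter.Bounds
import Mathlib.Analysis.SpecialFunctions.Complex.Circle
import HarnessLib

/-!
# rh-explicit (venture WeilGRH): the QUADRATIC ladder — elementary glue: real characters (`χ² = 1`) of small modulus (weil-3 gen20)

Cell `rh-explicit`, WEIL TRACK (structure seat weil-3, gen20).  Pure Mathlib facts for the rung «(−7/·) has the fifth-highest lowest zero among
quadratic Dirichlet `L`-functions»: a real character takes values in `{−1, 0, 1}` (`chi_apply_real_of_sq_eq_one`); a character which is `1` on a
generating set of the units is trivial (`eq_one_of_gen`, generators certified by `decide`); the even real characters of modulus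
`3, 7, 9, 11, 23` and the even characters with `χ(2) = 1` (mod `13, 15, 19, 21`) or `χ(3) = 1` (mod `17`) are trivial; mod `5` a real character
is even; the forced values of the odd real character mod `7` (`= (−7/·)`: `χ(2), χ(3), χ(4), χ(5) = 1, −1, 1, −1`) and of the even primitive
character mod `8` (`= (8/·)`: `χ(3), χ(5), χ(7) = −1, −1, 1`); odd real characters mod `9`, `11` have `χ(2) = −1`; an even
character mod `10` with `χ(3) = 1` is trivial.  RH/GRH-free; no definitions; standard axioms; nothing here bears on the truth of
RH or GRH.
-/

set_option autoImplicit false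

namespace Summit.Ventures.WeilGRH.Christoffel

open Complex

/-! ## Real characters -/

/-- A real character (`χ² = 1`) takes the values `−1, 0, 1`. -/
theorem chi_apply_real_of_sq_eq_one {q : ℕ} (χ : DirichletCharacter ℂ q) (hχ : χ ^ 2 = 1) (x : ZMod q) :
    χ x = -1 ∨ χ x = 0 ∨ χ x = 1 := by
  by_cases hu : IsUnit x
  · obtain ⟨u, hu⟩ := hu
    have hsq : χ x * χ x = 1 := by
      rw [← hu, ← pow_two, ← MulChar.pow_apply_coe, hχ, MulChar.one_apply_coe]
    rcases mul_self_eq_one_iff.1 hsq with h | h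
    · exact Or.inr (Or.inr h)
    · exact Or.inl h
  · exact Or.inr (Or.inl (χ.map_nonunit hu))

/-- For a real character and a unit `x`: `χ(x) = 1` or `χ(x) = −1`. -/
theorem chi_apply_unit_real {q : ℕ} (χ : DirichletCharacter ℂ q) (hχ : χ ^ 2 = 1) {x : ZMod q} (hu : IsUnit x) :
    χ x = 1 ∨ χ x = -1 := by
  rcases chi_apply_real_of_sq_eq_one χ hχ x with h | h | h
  · exact Or.inr h
  · exfalso
    obtain ⟨u, rfl⟩ := hu
    have h1 : ‖χ (u : ZMod q)‖ = 1 := χ.unit_norm_eq_one u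
    rw [h, norm_zero] at h1
    exact zero_ne_one h1
  · exact Or.inl h

/-! ## Triviality from a generating set -/

/-- If every unit is `± g^k` (`k < K`) and `χ(g) = χ(−1) = 1`, then `χ = 1`. -/
theorem eq_one_of_gen {n : ℕ} (χ : DirichletCharacter ℂ n) (g : ZMod n) (K : ℕ)
    (hgen : ∀ x : ZMod n, IsUnit x → ∃ k, k < K ∧ (x = g ^ k ∨ x = -(g ^ k))) (hg : χ g = 1) (hneg : χ (-1) = 1) :
    χ = 1 := by
  apply MulChar.ext'
  intro x
  by_cases hx : IsUnit x
  · rw [MulChar.one_apply hx]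
    obtain ⟨k, -, hk⟩ := hgen x hx
    rcases hk with rfl | rfl
    · rw [map_pow, hg, one_pow]
    · rw [neg_eq_neg_one_mul, map_mul, map_pow, hg, hneg, one_pow, one_mul]
  · rw [χ.map_nonunit hx, MulChar.map_nonunit _ hx]

/-! ## Generators of the units (kernel-decided) -/

/-- units mod `3` are `±1`. -/
theorem units_gen_mod3 : ∀ x : ZMod 3, IsUnit x → ∃ k, k < 1 ∧ (x = (1 : ZMod 3) ^ k ∨ x = -((1 : ZMod 3) ^ k)) := by decide
/-- units mod `7` are `± 2^k`, `k < 3`. -/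
theorem units_gen_mod7 : ∀ x : ZMod 7, IsUnit x → ∃ k, k < 3 ∧ (x = (2 : ZMod 7) ^ k ∨ x = -((2 : ZMod 7) ^ k)) := by decide
/-- units mod `9` are `± 2^k`, `k < 3`. -/
theorem units_gen_mod9 : ∀ x : ZMod 9, IsUnit x → ∃ k, k < 3 ∧ (x = (2 : ZMod 9) ^ k ∨ x = -((2 : ZMod 9) ^ k)) := by decide
/-- units mod `11` are `± 2^k`, `k < 5`. -/
theorem units_gen_mod11 : ∀ x : ZMod 11, IsUnit x → ∃ k, k < 5 ∧ (x = (2 : ZMod 11) ^ k ∨ x = -((2 : ZMod 11) ^ k)) := by decide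
/-- units mod `13` are `± 2^k`, `k < 6`. -/
theorem units_gen_mod13 : ∀ x : ZMod 13, IsUnit x → ∃ k, k < 6 ∧ (x = (2 : ZMod 13) ^ k ∨ x = -((2 : ZMod 13) ^ k)) := by decide
/-- units mod `15` are `± 2^k`, `k < 4`. -/
theorem units_gen_mod15 : ∀ x : ZMod 15, IsUnit x → ∃ k, k < 4 ∧ (x = (2 : ZMod 15) ^ k ∨ x = -((2 : ZMod 15) ^ k)) := by decide
/-- units mod `17` are `± 3^k`, `k < 8`. -/
theorem units_gen_mod17 : ∀ x : ZMod 17, IsUnit x → ∃ k, k < 8 ∧ (x = (3 : ZMod 17) ^ k ∨ x = -((3 : ZMod 17) ^ k)) := by decide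
/-- units mod `19` are `± 2^k`, `k < 9`. -/
theorem units_gen_mod19 : ∀ x : ZMod 19, IsUnit x → ∃ k, k < 9 ∧ (x = (2 : ZMod 19) ^ k ∨ x = -((2 : ZMod 19) ^ k)) := by decide
/-- units mod `21` are `± 2^k`, `k < 6`. -/
theorem units_gen_mod21 : ∀ x : ZMod 21, IsUnit x → ∃ k, k < 6 ∧ (x = (2 : ZMod 21) ^ k ∨ x = -((2 : ZMod 21) ^ k)) := by decide
/-- units mod `23` are `± 5^k`, `k < 11`. -/
theorem units_gen_mod23 : ∀ x : ZMod 23, IsUnit x → ∃ k, k < 11 ∧ (x = (5 : ZMod 23) ^ k ∨ x = -((5 : ZMod 23) ^ k)) := by decide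

/-! ## Even (real) characters of small modulus are trivial -/

/-- An even character mod `3` is trivial. -/
theorem eq_one_of_even_mod3 (χ : DirichletCharacter ℂ 3) (heven : χ (-1) = 1) : χ = 1 :=
  eq_one_of_gen χ 1 1 units_gen_mod3 (map_one χ) heven

/-- A real character mod `7` has `χ(2) = 1` (`2 = 3²`). -/
theorem chi_two_eq_one_of_real_mod7 (χ : DirichletCharacter ℂ 7) (hχ : χ ^ 2 = 1) : χ (2 : ZMod 7) = 1 := by
  have e : (2 : ZMod 7) = 3 * 3 := by decide
  rcases chi_apply_unit_real χ hχ (x := 3) (by decide) with h | h <;>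
    · rw [e, map_mul, h]; norm_num

/-- An even real character mod `7` is trivial. -/
theorem eq_one_of_even_real_mod7 (χ : DirichletCharacter ℂ 7) (hχ : χ ^ 2 = 1) (heven : χ (-1) = 1) : χ = 1 :=
  eq_one_of_gen χ 2 3 units_gen_mod7 (chi_two_eq_one_of_real_mod7 χ hχ) heven

/-- **The odd real character mod `7` (`= (−7/·)`) has `χ(3) = −1`, `χ(2) = 1`, `χ(4) = 1`, `χ(5) = −1`.** -/
theorem vals_of_odd_real_mod7 (χ : DirichletCharacter ℂ 7) (hχ : χ ^ 2 = 1) (hodd : χ (-1) = -1) :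
    χ (2 : ZMod 7) = 1 ∧ χ (3 : ZMod 7) = -1 ∧ χ (4 : ZMod 7) = 1 ∧ χ (5 : ZMod 7) = -1 := by
  have h2 := chi_two_eq_one_of_real_mod7 χ hχ
  have h3 : χ (3 : ZMod 7) = -1 := by
    rcases chi_apply_unit_real χ hχ (x := 3) (by decide) with h | h
    · exfalso
      have e : (-1 : ZMod 7) = 3 * 2 := by decide
      rw [e, map_mul, h, h2] at hodd; norm_num at hodd
    · exact h
  refine ⟨h2, h3, ?_, ?_⟩
  · rw [show (4 : ZMod 7) = 2 * 2 by decide, map_mul, h2]; norm_num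
  · rw [show (5 : ZMod 7) = -1 * 2 by decide, map_mul, hodd, h2]; norm_num

/-- An even real character mod `9` is trivial (`χ(2)³ = χ(−1) = 1` and `χ(2) = ±1`). -/
theorem eq_one_of_even_real_mod9 (χ : DirichletCharacter ℂ 9) (hχ : χ ^ 2 = 1) (heven : χ (-1) = 1) : χ = 1 := by
  have h2 : χ (2 : ZMod 9) = 1 := by
    rcases chi_apply_unit_real χ hχ (x := 2) (by decide) with h | h
    · exact h
    · exfalso
      have e : (-1 : ZMod 9) = 2 ^ 3 := by decide
      rw [e, map_pow, h] at heven; norm_num at heven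
  exact eq_one_of_gen χ 2 3 units_gen_mod9 h2 heven

/-- An even real character mod `11` is trivial (`χ(2)⁵ = χ(−1)`). -/
theorem eq_one_of_even_real_mod11 (χ : DirichletCharacter ℂ 11) (hχ : χ ^ 2 = 1) (heven : χ (-1) = 1) : χ = 1 := by
  have h2 : χ (2 : ZMod 11) = 1 := by
    rcases chi_apply_unit_real χ hχ (x := 2) (by decide) with h | h
    · exact h
    · exfalso
      have e : (-1 : ZMod 11) = 2 ^ 5 := by decide
      rw [e, map_pow, h] at heven; norm_num at heven
  exact eq_one_of_gen χ 2 5 units_gen_mod11 h2 heven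

/-- A character mod `13` with `χ(2) = 1` is trivial (`2` generates; `−1 = 2⁶`). -/
theorem eq_one_of_chi_two_eq_one_mod13 (χ : DirichletCharacter ℂ 13) (h2 : χ (2 : ZMod 13) = 1) : χ = 1 :=
  eq_one_of_gen χ 2 6 units_gen_mod13 h2 (by rw [show (-1 : ZMod 13) = 2 ^ 6 by decide, map_pow, h2, one_pow])

/-- An even character mod `15` with `χ(2) = 1` is trivial. -/
theorem eq_one_of_even_chi_two_eq_one_mod15 (χ : DirichletCharacter ℂ 15) (h2 : χ (2 : ZMod 15) = 1) (heven : χ (-1) = 1) : χ = 1 :=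
  eq_one_of_gen χ 2 4 units_gen_mod15 h2 heven

/-- An even character mod `17` with `χ(3) = 1` is trivial (`3` generates). -/
theorem eq_one_of_even_chi_three_eq_one_mod17 (χ : DirichletCharacter ℂ 17) (h3 : χ (3 : ZMod 17) = 1) (heven : χ (-1) = 1) :
    χ = 1 :=
  eq_one_of_gen χ 3 8 units_gen_mod17 h3 heven

/-- An even character mod `19` with `χ(2) = 1` is trivial (`2` generates). -/
theorem eq_one_of_even_chi_two_eq_one_mod19 (χ : DirichletCharacter ℂ 19) (h2 : χ (2 : ZMod 19) = 1) (heven : χ (-1) = 1) : χ = 1 :=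
  eq_one_of_gen χ 2 9 units_gen_mod19 h2 heven

/-- An even character mod `21` with `χ(2) = 1` is trivial. -/
theorem eq_one_of_even_chi_two_eq_one_mod21 (χ : DirichletCharacter ℂ 21) (h2 : χ (2 : ZMod 21) = 1) (heven : χ (-1) = 1) : χ = 1 :=
  eq_one_of_gen χ 2 6 units_gen_mod21 h2 heven

/-- An even real character mod `23` is trivial (`χ(5)¹¹ = χ(−1)`, `5` generates). -/
theorem eq_one_of_even_real_mod23 (χ : DirichletCharacter ℂ 23) (hχ : χ ^ 2 = 1) (heven : χ (-1) = 1) : χ = 1 := by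
  have h5 : χ (5 : ZMod 23) = 1 := by
    rcases chi_apply_unit_real χ hχ (x := 5) (by decide) with h | h
    · exact h
    · exfalso
      have e : (-1 : ZMod 23) = 5 ^ 11 := by decide
      rw [e, map_pow, h] at heven; norm_num at heven
  exact eq_one_of_gen χ 5 11 units_gen_mod23 h5 heven

/-! ## Odd real characters mod `9`, `11`; even characters mod `10` -/

/-- An odd real character mod `9` has `χ(2) = −1` (`χ(2)³ = χ(−1) = −1`). -/
theorem chi_two_eq_neg_one_of_odd_real_mod9 (χ : DirichletCharacter ℂ 9) (hχ : χ ^ 2 = 1) (hodd : χ (-1) = -1) :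
    χ (2 : ZMod 9) = -1 := by
  rcases chi_apply_unit_real χ hχ (x := 2) (by decide) with h | h
  · exfalso
    have e : (-1 : ZMod 9) = 2 ^ 3 := by decide
    rw [e, map_pow, h] at hodd; norm_num at hodd
  · exact h

/-- An odd real character mod `11` has `χ(2) = −1` (`χ(2)⁵ = χ(−1) = −1`). -/
theorem chi_two_eq_neg_one_of_odd_real_mod11 (χ : DirichletCharacter ℂ 11) (hχ : χ ^ 2 = 1) (hodd : χ (-1) = -1) :
    χ (2 : ZMod 11) = -1 := by
  rcases chi_apply_unit_real χ hχ (x := 2) (by decide) with h | h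
  · exfalso
    have e : (-1 : ZMod 11) = 2 ^ 5 := by decide
    rw [e, map_pow, h] at hodd; norm_num at hodd
  · exact h

/-- units mod `10` are `± 3^k`, `k < 2`. -/
theorem units_gen_mod10 : ∀ x : ZMod 10, IsUnit x → ∃ k, k < 2 ∧ (x = (3 : ZMod 10) ^ k ∨ x = -((3 : ZMod 10) ^ k)) := by decide

/-- An even character mod `10` with `χ(3) = 1` is trivial. -/
theorem eq_one_of_even_chi_three_eq_one_mod10 (χ : DirichletCharacter ℂ 10) (h3 : χ (3 : ZMod 10) = 1) (heven : χ (-1) = 1) :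
    χ = 1 :=
  eq_one_of_gen χ 3 2 units_gen_mod10 h3 heven

/-! ## Modulus `5` and `8` -/

/-- A real character mod `5` is even (`χ(−1) = χ(2)² = 1`). -/
theorem even_of_real_mod5 (χ : DirichletCharacter ℂ 5) (hχ : χ ^ 2 = 1) : χ (-1) = 1 := by
  have e : (-1 : ZMod 5) = 2 * 2 := by decide
  rcases chi_apply_unit_real χ hχ (x := 2) (by decide) with h | h <;>
    · rw [e, map_mul, h]; norm_num

/-- units mod `8` are `1, 3, 5, 7`. -/
theorem units_mod8 : ∀ x : ZMod 8, IsUnit x → x = 1 ∨ x = 3 ∨ x = 5 ∨ x = 3 * 5 := by decide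

/-- **An even character mod `8` with `χ(3) = 1` is trivial**; hence the even PRIMITIVE character mod `8` (`= (8/·)`) has `χ(3) = χ(5) = −1`. -/
theorem vals_of_even_primitive_mod8 (χ : DirichletCharacter ℂ 8) (hprim : χ.IsPrimitive) (heven : χ (-1) = 1) :
    χ (3 : ZMod 8) = -1 ∧ χ (5 : ZMod 8) = -1 ∧ χ (7 : ZMod 8) = 1 := by
  have h7 : χ (7 : ZMod 8) = 1 := by rw [show (7 : ZMod 8) = -1 by decide]; exact heven
  have hsq3 : χ (3 : ZMod 8) * χ (3 : ZMod 8) = 1 := by rw [← map_mul, show (3 : ZMod 8) * 3 = 1 by decide, map_one]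
  have h35 : χ (3 : ZMod 8) * χ (5 : ZMod 8) = 1 := by rw [← map_mul, show (3 : ZMod 8) * 5 = -1 by decide, heven]
  rcases mul_self_eq_one_iff.1 hsq3 with h3 | h3
  · exfalso
    have h5 : χ (5 : ZMod 8) = 1 := by rw [h3, one_mul] at h35; exact h35
    have h1 : χ = 1 := by
      apply MulChar.ext'
      intro x
      by_cases hx : IsUnit x
      · rw [MulChar.one_apply hx]
        rcases units_mod8 x hx with rfl | rfl | rfl | rfl
        · exact map_one χ
        · exact h3
        · exact h5
        · rw [map_mul, h3, h5, one_mul]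
      · rw [χ.map_nonunit hx, MulChar.map_nonunit _ hx]
    rw [h1] at hprim
    have hc : (1 : DirichletCharacter ℂ 8).conductor = 8 := hprim
    rw [DirichletCharacter.conductor_one] at hc
    omega
  · have h5 : χ (5 : ZMod 8) = -1 := by
      rw [h3] at h35
      have : χ (5 : ZMod 8) = -1 * (-1 * χ (5 : ZMod 8)) := by ring
      rw [this, h35]; norm_num
    exact ⟨h3, h5, h7⟩

end Summit.Ventures.WeilGRH.Christoffel
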